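import Mathlib
import HarnessLib
import Summits.HubbardSuperconductivity.HubbardSuperconductivity.Theses.ChiralWindow
import Summits.HubbardSuperconductivity.HubbardSuperconductivity.Theorems.ChiralWindowCwKLChiralWindowReduction
import Summits.HubbardSuperconductivity.HubbardSuperconductivity.Theorems.ChiralWindowCwChannelInfContinuousTransport
import Literature.MathematicalPhysics.QuantumLattice.KohnLuttingerKernelPolarL2
import Literature.MathematicalPhysics.QuantumLattice.HubbardPairEnergySublevel
import Literature.MathematicalPhysics.QuantumLattice.HubbardBandShellVolume
import Literature.MathematicalPhysics.QuantumLattice.KohnLuttingerPairingFormPolar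

/-!
# Crux `CwKLChiralWindow` (stmt-HubbardSuperconductivity-1741): the reduction without the sup-bound (B)

Route `HubbardSuperconductivity/ChiralWindow`, line `Sketch`, stub `stub_klReductionL2`.
Write `ε₀ = squareDispersion 1 0`, `μ_δ = chemicalPotentialOfDensity ε₀ (1-δ)`, `σ = fermiCurveMeasure ε₀ μ`,
`χ₀ = lindhardFunction ε₀ μ`, `Γ_U(k,k') = U + U² χ₀(k+k')`, `Λ_U(δ,χ) = channelInf ε₀ μ_δ U χ`.

`cwKLChiralWindow_of_certificate` (tree, `…CwKLChiralWindowReduction`) derives the crux from the `U = 1`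
certificate (C) AND a sup-bound (B) `|χ₀(k+k')| ≤ C_δ` on the Fermi curve, used only to split the pairing form
`⟨ψ, Γ_U ψ⟩ = U (∫ψ dσ)² + U² Q(ψ)` and to bound the `U = 1` image set from below.  Here (B) is dispensed with:
for `-4 < μ < 0` the weighted polar kernel `M_U(θ,θ') = w(θ) Γ_U(γθ, γθ') w(θ')` (`γ = fermiPolar μ`,
`w = fermiPolarDOS μ`) is Hilbert–Schmidt on `L²(dθ ⌞ (-π,π])` (`memLp_klKernelPolar`, fed by
`exists_torusSublevel_le`, `exists_shellVolume_le`), the pairing form is the quadratic form of `M_U` on the profile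
`Ψ = ψ ∘ γ ∈ L²(dθ)` (`pairingForm_eq_polar`, `integral_mul_integral_mul_eq_integral_prod`), and pointwise
`M_U - U² M_1 = (U - U²) w ⊗ w`, whence

`⟨ψ, Γ_U ψ⟩ - U² ⟨ψ, Γ_1 ψ⟩ = (U - U²) (∫ w Ψ dθ)² = (U - U²) (∫ ψ dσ)²`   (`kl_rl_pairingForm_sub`),

while the image of the channel-state set under `⟨·, Γ_1 ·⟩` is bounded below (`pairingForm_bddBelow_image`).  These
give the three frame consequences (`U²`-homogeneity off `A1g`, bare-`U` penalty, `U`-free minimisers) and the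
assembly of `cwKLChiralWindow_of_certificate` goes through verbatim (`stub_klReductionL2`).

References: S. Raghu, S. A. Kivelson, D. J. Scalapino, Phys. Rev. B 81 (2010) 224505, §II (7), (13).
-/

noncomputable section

set_option linter.dupNamespace false

namespace Summit.HubbardSuperconductivity.HubbardSuperconductivity.Theorems

open MeasureTheory Literature.MathematicalPhysics.QuantumLattice
open Summit.HubbardSuperconductivity.HubbardSuperconductivity.Theses.ChiralWindow
open scoped Pointwise

/-! ### The Hilbert–Schmidt frame at a band level `-4 < μ < 0` -/

section Band

variable {μ : ℝ} (hμ₁ : -4 < μ) (hμ₂ : μ < 0)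
include hμ₁ hμ₂

/-- The weighted polar kernel `M_U` is in `L²(dθ dθ')` for every `U` (the torus-sublevel and shell-volume
estimates hold at the single level `μ`). [folklore] -/
theorem kl_rl_memLp_kernelPolar (U : ℝ) :
    MemLp (fun z : ℝ × ℝ => fermiPolarDOS μ (Prod.fst z) *
        kohnLuttingerKernel (squareDispersion 1 0) μ U (fermiPolar μ (Prod.fst z)) (fermiPolar μ (Prod.snd z)) *
        fermiPolarDOS μ (Prod.snd z)) 2
      ((volume.restrict (Set.Ioc (-Real.pi) Real.pi)).prod (volume.restrict (Set.Ioc (-Real.pi) Real.pi))) := by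
  obtain ⟨C, β, hC, hβ0, hβ2, hTSL⟩ := exists_torusSublevel_le (μ₁ := μ) (μ₂ := μ) hμ₁ hμ₂
  obtain ⟨Csh, hCsh, hSV⟩ := exists_shellVolume_le (μ₁ := μ) (μ₂ := μ) hμ₁ hμ₂
  have hμI : μ ∈ Set.Icc μ μ := ⟨le_rfl, le_rfl⟩
  exact memLp_klKernelPolar hμ₁ hμ₂ U hC hβ0 hβ2 hCsh (hTSL μ hμI) (hSV μ hμI)

/-- **Splitting of the pairing form without a sup-bound.** For `ψ ∈ L²(σ)`,
`⟨ψ, Γ_U ψ⟩ - U² ⟨ψ, Γ_1 ψ⟩ = (U - U²) (∫ ψ dσ)²`: both forms are product integrals of the `L²` kernels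
`M_U`, `M_1` against `Ψ ⊗ Ψ`, and `M_U - U² M_1 = (U - U²) w ⊗ w` pointwise.
[cite: RaghuKivelsonScalapino2010, §II (7)] -/
theorem kl_rl_pairingForm_sub (U : ℝ) {ψ : Momentum → ℝ}
    (hψ : MemLp ψ 2 (fermiCurveMeasure (squareDispersion 1 0) μ)) :
    pairingForm (squareDispersion 1 0) μ U ψ - U ^ 2 * pairingForm (squareDispersion 1 0) μ 1 ψ =
      (U - U ^ 2) * (∫ k, ψ k ∂fermiCurveMeasure (squareDispersion 1 0) μ) ^ 2 := by
  -- the parameter interval `(-π, π]` with Lebesgue measure, and the weighted polar kernels `M_U`, `M_1`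
  set ν : Measure ℝ := volume.restrict (Set.Ioc (-Real.pi) Real.pi) with hν
  set MU : ℝ × ℝ → ℝ := fun z => fermiPolarDOS μ (Prod.fst z) *
    kohnLuttingerKernel (squareDispersion 1 0) μ U (fermiPolar μ (Prod.fst z)) (fermiPolar μ (Prod.snd z)) *
    fermiPolarDOS μ (Prod.snd z) with hMU_def
  set M1 : ℝ × ℝ → ℝ := fun z => fermiPolarDOS μ (Prod.fst z) *
    kohnLuttingerKernel (squareDispersion 1 0) μ 1 (fermiPolar μ (Prod.fst z)) (fermiPolar μ (Prod.snd z)) *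
    fermiPolarDOS μ (Prod.snd z) with hM1_def
  obtain ⟨w₀, w₁, hw₀, hw⟩ := exists_bounds_fermiPolarDOS hμ₁ hμ₂
  obtain ⟨hΨ, -⟩ := memLp_profile hμ₁ hμ₂ hψ hw₀ (fun θ => (hw θ).1)
  have hT := memLp_two_tensor hΨ
  have hMU : MemLp MU 2 (ν.prod ν) := kl_rl_memLp_kernelPolar hμ₁ hμ₂ U
  have hM1 : MemLp M1 2 (ν.prod ν) := kl_rl_memLp_kernelPolar hμ₁ hμ₂ 1
  have hIU : Integrable (fun z : ℝ × ℝ => MU z * (ψ (fermiPolar μ z.1) * ψ (fermiPolar μ z.2))) (ν.prod ν) :=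
    hMU.integrable_mul hT
  have hI1 : Integrable (fun z : ℝ × ℝ => M1 z * (ψ (fermiPolar μ z.1) * ψ (fermiPolar μ z.2))) (ν.prod ν) :=
    hM1.integrable_mul hT
  have hpU : pairingForm (squareDispersion 1 0) μ U ψ =
      ∫ z, MU z * (ψ (fermiPolar μ z.1) * ψ (fermiPolar μ z.2)) ∂(ν.prod ν) := by
    rw [pairingForm_eq_polar hμ₁ hμ₂ U hψ.1]
    exact integral_mul_integral_mul_eq_integral_prod hΨ hMU
  have hp1 : pairingForm (squareDispersion 1 0) μ 1 ψ =
      ∫ z, M1 z * (ψ (fermiPolar μ z.1) * ψ (fermiPolar μ z.2)) ∂(ν.prod ν) := by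
    rw [pairingForm_eq_polar hμ₁ hμ₂ 1 hψ.1]
    exact integral_mul_integral_mul_eq_integral_prod hΨ hM1
  have hmean : ∫ k, ψ k ∂fermiCurveMeasure (squareDispersion 1 0) μ =
      ∫ θ, fermiPolarDOS μ θ * ψ (fermiPolar μ θ) ∂ν :=
    integral_fermiCurveMeasure hμ₁ hμ₂ hψ.1
  rw [hpU, hp1, hmean, ← integral_const_mul (U ^ 2), ← integral_sub hIU (hI1.const_mul _),
    sq (∫ θ, fermiPolarDOS μ θ * ψ (fermiPolar μ θ) ∂ν),
    ← integral_prod_mul (μ := ν) (ν := ν) (fun θ => fermiPolarDOS μ θ * ψ (fermiPolar μ θ))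
      (fun θ => fermiPolarDOS μ θ * ψ (fermiPolar μ θ)), ← integral_const_mul]
  refine integral_congr_ae (Filter.Eventually.of_forall fun z => ?_)
  simp only [hMU_def, hM1_def, kohnLuttingerKernel]
  ring

/-- The image of the channel-state set under `⟨·, Γ_U ·⟩` is bounded below (Hilbert–Schmidt bound of the
polar kernel). [folklore] -/
theorem kl_rl_bddBelow (U : ℝ) (χ : D4Irrep) :
    BddBelow ((pairingForm (squareDispersion 1 0) μ U) '' {ψ | IsChannelState (squareDispersion 1 0) μ χ ψ}) := by
  obtain ⟨w₀, w₁, hw₀, hw⟩ := exists_bounds_fermiPolarDOS hμ₁ hμ₂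
  exact pairingForm_bddBelow_image hμ₁ hμ₂ U χ hw₀ (fun θ => (hw θ).1) (kl_rl_memLp_kernelPolar hμ₁ hμ₂ U)

/-- **`U²`-homogeneity of the pairing form on a mean-zero `L²(σ)` gap function.**
[cite: RaghuKivelsonScalapino2010, §II (7)] -/
theorem kl_rl_pairingForm_sq (U : ℝ) {ψ : Momentum → ℝ}
    (hψ : MemLp ψ 2 (fermiCurveMeasure (squareDispersion 1 0) μ))
    (h0 : ∫ k, ψ k ∂fermiCurveMeasure (squareDispersion 1 0) μ = 0) :
    pairingForm (squareDispersion 1 0) μ U ψ = U ^ 2 * pairingForm (squareDispersion 1 0) μ 1 ψ := by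
  have h := kl_rl_pairingForm_sub hμ₁ hμ₂ U hψ
  rw [h0] at h
  have : (U - U ^ 2) * (0 : ℝ) ^ 2 = 0 := by ring
  linarith

/-- **`U²`-homogeneity of the channel bottom** when every state of the channel has vanishing mean
(`sInf (c • S) = c • sInf S` for `c ≥ 0`). [cite: RaghuKivelsonScalapino2010, §II (7)] -/
theorem kl_rl_channelInf_sq_of_meanZero (U : ℝ) (χ : D4Irrep)
    (hmean : ∀ ψ, IsChannelState (squareDispersion 1 0) μ χ ψ →
      ∫ k, ψ k ∂fermiCurveMeasure (squareDispersion 1 0) μ = 0) :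
    channelInf (squareDispersion 1 0) μ U χ = U ^ 2 * channelInf (squareDispersion 1 0) μ 1 χ := by
  unfold channelInf
  have himg : (pairingForm (squareDispersion 1 0) μ U) '' {ψ | IsChannelState (squareDispersion 1 0) μ χ ψ}
      = (U ^ 2) • ((pairingForm (squareDispersion 1 0) μ 1) '' {ψ | IsChannelState (squareDispersion 1 0) μ χ ψ}) := by
    rw [← Set.image_smul, Set.image_image]
    apply Set.image_congr
    intro ψ hψ
    show pairingForm (squareDispersion 1 0) μ U ψ = U ^ 2 • pairingForm (squareDispersion 1 0) μ 1 ψ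
    rw [smul_eq_mul]
    exact kl_rl_pairingForm_sq hμ₁ hμ₂ U hψ.1 (hmean ψ hψ)
  rw [himg, Real.sInf_smul_of_nonneg (sq_nonneg U), smul_eq_mul]

/-- **The bare-`U` penalty.** For `0 < U ≤ 1` and any channel, `U² Λ_1 ≤ Λ_U`: state by state
`⟨ψ, Γ_U ψ⟩ - U² ⟨ψ, Γ_1 ψ⟩ = (U - U²)(∫ψ)² ≥ 0`, and the `U = 1` image set is bounded below.
[cite: RaghuKivelsonScalapino2010, §II (7)] -/
theorem kl_rl_sq_channelInf_one_le {U : ℝ} (hU0 : 0 < U) (hU1 : U ≤ 1) (χ : D4Irrep) :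
    U ^ 2 * channelInf (squareDispersion 1 0) μ 1 χ ≤ channelInf (squareDispersion 1 0) μ U χ := by
  unfold channelInf
  set S := {ψ | IsChannelState (squareDispersion 1 0) μ χ ψ} with hS
  rcases (pairingForm (squareDispersion 1 0) μ U '' S).eq_empty_or_nonempty with hSe | hSne
  · have hSe' : pairingForm (squareDispersion 1 0) μ 1 '' S = ∅ := by
      rw [Set.image_eq_empty] at hSe ⊢; exact hSe
    rw [hSe, hSe', Real.sInf_empty, mul_zero]
  · have hbb : BddBelow (pairingForm (squareDispersion 1 0) μ 1 '' S) := kl_rl_bddBelow hμ₁ hμ₂ 1 χ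
    refine le_csInf hSne ?_
    rintro x ⟨ψ, hψ, rfl⟩
    have hle : sInf (pairingForm (squareDispersion 1 0) μ 1 '' S) ≤ pairingForm (squareDispersion 1 0) μ 1 ψ :=
      csInf_le hbb ⟨ψ, hψ, rfl⟩
    have hsub := kl_rl_pairingForm_sub hμ₁ hμ₂ U hψ.1
    have hI := sq_nonneg (∫ k, ψ k ∂fermiCurveMeasure (squareDispersion 1 0) μ)
    have hUU : 0 ≤ U - U ^ 2 := by nlinarith
    have h1 : U ^ 2 * sInf (pairingForm (squareDispersion 1 0) μ 1 '' S) ≤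
        U ^ 2 * pairingForm (squareDispersion 1 0) μ 1 ψ := mul_le_mul_of_nonneg_left hle (sq_nonneg U)
    nlinarith [mul_nonneg hUU hI]

end Band

/-! ### The reduction -/

/-- **Stub `stub_klReductionL2`: the reduction without (B).** The `U = 1` certificate (C) — partner
`χs ∉ {B1g, A2g, A1g}`, window `[a,b] ⊆ [3/10,12/25]`, margins `γ, c > 0`, clauses (i)–(iii) for `Λ_1` and the
node covering (iv) by bottom states at `U = 1` — implies `CwKLChiralWindow` (displayed unfolded; `U₁ = 1`).  Same
frame as `cwKLChiralWindow_of_certificate` (`U²`-homogeneity off `A1g`, bare-`U` penalty, transfer of (iv)), with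
the sup-bound (B) on `χ₀` replaced by the Hilbert–Schmidt property of the weighted polar kernel
(`memLp_klKernelPolar`, `exists_torusSublevel_le`, `exists_shellVolume_le`).
[cite: RaghuKivelsonScalapino2010, §II (7) and (13)] -/
theorem stub_klReductionL2 :
    (∃ χs : D4Irrep, χs ≠ D4Irrep.B1g ∧ χs ≠ D4Irrep.A2g ∧ χs ≠ D4Irrep.A1g ∧
    ∃ a b γ c : ℝ, 3/10 ≤ a ∧ a < b ∧ b ≤ 12/25 ∧ 0 < γ ∧ 0 < c ∧
    (∀ χ, χ ≠ D4Irrep.B1g →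
      channelInf (squareDispersion 1 0) (chemicalPotentialOfDensity (squareDispersion 1 0) (1 - a)) 1 D4Irrep.B1g + γ ≤
        channelInf (squareDispersion 1 0) (chemicalPotentialOfDensity (squareDispersion 1 0) (1 - a)) 1 χ) ∧
    (∀ χ, χ ≠ χs →
      channelInf (squareDispersion 1 0) (chemicalPotentialOfDensity (squareDispersion 1 0) (1 - b)) 1 χs + γ ≤
        channelInf (squareDispersion 1 0) (chemicalPotentialOfDensity (squareDispersion 1 0) (1 - b)) 1 χ) ∧
    (∀ δ ∈ Set.Icc a b, ∀ χ, χ ≠ D4Irrep.B1g → χ ≠ χs →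
      min (channelInf (squareDispersion 1 0) (chemicalPotentialOfDensity (squareDispersion 1 0) (1 - δ)) 1 D4Irrep.B1g)
          (channelInf (squareDispersion 1 0) (chemicalPotentialOfDensity (squareDispersion 1 0) (1 - δ)) 1 χs) + γ ≤
        channelInf (squareDispersion 1 0) (chemicalPotentialOfDensity (squareDispersion 1 0) (1 - δ)) 1 χ) ∧
    (∀ δ ∈ Set.Icc a b, ∃ (g : Momentum → ℝ) (n : ℕ) (f : Fin n → Momentum → ℝ),
      IsChannelState (squareDispersion 1 0) (chemicalPotentialOfDensity (squareDispersion 1 0) (1 - δ)) D4Irrep.B1g g ∧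
      pairingForm (squareDispersion 1 0) (chemicalPotentialOfDensity (squareDispersion 1 0) (1 - δ)) 1 g =
        channelInf (squareDispersion 1 0) (chemicalPotentialOfDensity (squareDispersion 1 0) (1 - δ)) 1 D4Irrep.B1g ∧
      (∀ i, IsChannelState (squareDispersion 1 0) (chemicalPotentialOfDensity (squareDispersion 1 0) (1 - δ)) χs (f i) ∧
        pairingForm (squareDispersion 1 0) (chemicalPotentialOfDensity (squareDispersion 1 0) (1 - δ)) 1 (f i) =
          channelInf (squareDispersion 1 0) (chemicalPotentialOfDensity (squareDispersion 1 0) (1 - δ)) 1 χs) ∧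
      (Pairwise fun i j => ∫ k, f i k * f j k
        ∂fermiCurveMeasure (squareDispersion 1 0) (chemicalPotentialOfDensity (squareDispersion 1 0) (1 - δ)) = 0) ∧
      ∀ᵐ k ∂fermiCurveMeasure (squareDispersion 1 0) (chemicalPotentialOfDensity (squareDispersion 1 0) (1 - δ)),
        c ≤ g k ^ 2 + ∑ i, f i k ^ 2)) →
    ∃ χs : D4Irrep, χs ≠ D4Irrep.B1g ∧ χs ≠ D4Irrep.A2g ∧ ∃ a b γ c U₁ : ℝ, 3/10 ≤ a ∧ a < b ∧ b ≤ 12/25 ∧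
      0 < γ ∧ 0 < c ∧ 0 < U₁ ∧ ∀ U ∈ Set.Ioo (0:ℝ) U₁,
      let ε : Momentum → ℝ := squareDispersion 1 0
      let μ : ℝ → ℝ := fun δ => chemicalPotentialOfDensity ε (1 - δ)
      let Λ : ℝ → D4Irrep → ℝ := fun δ χ => channelInf ε (μ δ) U χ
      (∀ χ, χ ≠ D4Irrep.B1g → Λ a D4Irrep.B1g + γ * U ^ 2 ≤ Λ a χ) ∧
      (∀ χ, χ ≠ χs → Λ b χs + γ * U ^ 2 ≤ Λ b χ) ∧
      (∀ δ ∈ Set.Icc a b, ∀ χ, χ ≠ D4Irrep.B1g → χ ≠ χs → min (Λ δ D4Irrep.B1g) (Λ δ χs) + γ * U ^ 2 ≤ Λ δ χ) ∧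
      (∀ δ ∈ Set.Icc a b, ∃ (g : Momentum → ℝ) (n : ℕ) (f : Fin n → Momentum → ℝ),
        IsChannelState ε (μ δ) D4Irrep.B1g g ∧ pairingForm ε (μ δ) U g = Λ δ D4Irrep.B1g ∧
        (∀ i, IsChannelState ε (μ δ) χs (f i) ∧ pairingForm ε (μ δ) U (f i) = Λ δ χs) ∧
        (Pairwise fun i j => ∫ k, f i k * f j k ∂fermiCurveMeasure ε (μ δ) = 0) ∧
        ∀ᵐ k ∂fermiCurveMeasure ε (μ δ), c ≤ g k ^ 2 + ∑ i, f i k ^ 2) := by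
  intro hCert
  obtain ⟨χs, hsB1, hsA2, hsA1, a, b, γ, c, ha, hab, hb, hγ, hc, hi, hii, hiii, hiv⟩ := hCert
  have hwin : ∀ δ ∈ Set.Icc a b, δ ∈ Set.Icc (3/10:ℝ) (12/25) :=
    fun δ hδ => ⟨le_trans ha hδ.1, le_trans hδ.2 hb⟩
  have hμ : ∀ δ ∈ Set.Icc a b,
      chemicalPotentialOfDensity (squareDispersion 1 0) (1 - δ) ∈ Set.Ioo (-4:ℝ) 0 :=
    fun δ hδ => stub_klMuWindow δ (hwin δ hδ)
  have hfin : ∀ δ ∈ Set.Icc a b, IsFiniteMeasure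
      (fermiCurveMeasure (squareDispersion 1 0) (chemicalPotentialOfDensity (squareDispersion 1 0) (1 - δ))) :=
    fun δ hδ => stub_klFiniteMeasure stub_klGradient stub_klHausdorffFinite _ (hμ δ hδ)
  have hinv : ∀ δ ∈ Set.Icc a b, ∀ γ' : DihedralGroup 4, MeasurePreserving (d4Momentum γ')
      (fermiCurveMeasure (squareDispersion 1 0) (chemicalPotentialOfDensity (squareDispersion 1 0) (1 - δ)))
      (fermiCurveMeasure (squareDispersion 1 0) (chemicalPotentialOfDensity (squareDispersion 1 0) (1 - δ))) :=
    fun δ hδ => stub_klD4Invariant stub_klGradient _ (hμ δ hδ)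
  have hmean : ∀ δ ∈ Set.Icc a b, ∀ (χ : D4Irrep) (ψ : Momentum → ℝ), χ ≠ D4Irrep.A1g →
      IsChannelState (squareDispersion 1 0) (chemicalPotentialOfDensity (squareDispersion 1 0) (1 - δ)) χ ψ →
      ∫ k, ψ k ∂fermiCurveMeasure (squareDispersion 1 0)
        (chemicalPotentialOfDensity (squareDispersion 1 0) (1 - δ)) = 0 :=
    fun δ hδ χ ψ hχ hψ => (stub_klMeanZero _ _ (hfin δ hδ) (hinv δ hδ) χ ψ hχ hψ).2
  -- the three consequences of the Hilbert–Schmidt frame, per doping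
  have hhom : ∀ δ ∈ Set.Icc a b, ∀ (U : ℝ) (χ : D4Irrep), χ ≠ D4Irrep.A1g →
      channelInf (squareDispersion 1 0) (chemicalPotentialOfDensity (squareDispersion 1 0) (1 - δ)) U χ =
        U ^ 2 * channelInf (squareDispersion 1 0) (chemicalPotentialOfDensity (squareDispersion 1 0) (1 - δ)) 1 χ :=
    fun δ hδ U χ hχ => kl_rl_channelInf_sq_of_meanZero (hμ δ hδ).1 (hμ δ hδ).2 U χ
      (fun ψ hψ => hmean δ hδ χ ψ hχ hψ)
  have hpen : ∀ δ ∈ Set.Icc a b, ∀ U ∈ Set.Ioo (0:ℝ) 1, ∀ χ : D4Irrep,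
      U ^ 2 * channelInf (squareDispersion 1 0) (chemicalPotentialOfDensity (squareDispersion 1 0) (1 - δ)) 1 χ ≤
        channelInf (squareDispersion 1 0) (chemicalPotentialOfDensity (squareDispersion 1 0) (1 - δ)) U χ :=
    fun δ hδ U hU χ => kl_rl_sq_channelInf_one_le (hμ δ hδ).1 (hμ δ hδ).2 hU.1 hU.2.le χ
  have hform : ∀ δ ∈ Set.Icc a b, ∀ (U : ℝ) (χ : D4Irrep) (ψ : Momentum → ℝ), χ ≠ D4Irrep.A1g →
      IsChannelState (squareDispersion 1 0) (chemicalPotentialOfDensity (squareDispersion 1 0) (1 - δ)) χ ψ →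
      pairingForm (squareDispersion 1 0) (chemicalPotentialOfDensity (squareDispersion 1 0) (1 - δ)) U ψ =
        U ^ 2 * pairingForm (squareDispersion 1 0) (chemicalPotentialOfDensity (squareDispersion 1 0) (1 - δ)) 1 ψ :=
    fun δ hδ U χ ψ hχ hψ => kl_rl_pairingForm_sq (hμ δ hδ).1 (hμ δ hδ).2 U hψ.1 (hmean δ hδ χ ψ hχ hψ)
  have haI : a ∈ Set.Icc a b := Set.left_mem_Icc.2 hab.le
  have hbI : b ∈ Set.Icc a b := Set.right_mem_Icc.2 hab.le
  refine ⟨χs, hsB1, hsA2, a, b, γ, c, 1, ha, hab, hb, hγ, hc, one_pos, ?_⟩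
  intro U hU
  have hU2 : 0 ≤ U ^ 2 := sq_nonneg U
  refine ⟨?_, ?_, ?_, ?_⟩
  · -- (i) at δ = a
    intro χ hχ
    show channelInf (squareDispersion 1 0) (chemicalPotentialOfDensity (squareDispersion 1 0) (1 - a)) U
        D4Irrep.B1g + γ * U ^ 2 ≤
      channelInf (squareDispersion 1 0) (chemicalPotentialOfDensity (squareDispersion 1 0) (1 - a)) U χ
    rw [hhom a haI U D4Irrep.B1g (by decide)]
    have h1 := mul_le_mul_of_nonneg_left (hi χ hχ) hU2
    have h2 := hpen a haI U hU χ
    nlinarith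
  · -- (ii) at δ = b
    intro χ hχ
    show channelInf (squareDispersion 1 0) (chemicalPotentialOfDensity (squareDispersion 1 0) (1 - b)) U χs
        + γ * U ^ 2 ≤
      channelInf (squareDispersion 1 0) (chemicalPotentialOfDensity (squareDispersion 1 0) (1 - b)) U χ
    rw [hhom b hbI U χs hsA1]
    have h1 := mul_le_mul_of_nonneg_left (hii χ hχ) hU2
    have h2 := hpen b hbI U hU χ
    nlinarith
  · -- (iii) isolation on [a, b]
    intro δ hδ χ hχ1 hχ2
    show min (channelInf (squareDispersion 1 0) (chemicalPotentialOfDensity (squareDispersion 1 0) (1 - δ)) U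
          D4Irrep.B1g)
        (channelInf (squareDispersion 1 0) (chemicalPotentialOfDensity (squareDispersion 1 0) (1 - δ)) U χs)
        + γ * U ^ 2 ≤
      channelInf (squareDispersion 1 0) (chemicalPotentialOfDensity (squareDispersion 1 0) (1 - δ)) U χ
    rw [hhom δ hδ U D4Irrep.B1g (by decide), hhom δ hδ U χs hsA1]
    have h1 := mul_le_mul_of_nonneg_left (hiii δ hδ χ hχ1 hχ2) hU2
    have h2 := hpen δ hδ U hU χ
    have h3 := kl_min_mul_le (U ^ 2) (channelInf (squareDispersion 1 0)
      (chemicalPotentialOfDensity (squareDispersion 1 0) (1 - δ)) 1 D4Irrep.B1g)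
      (channelInf (squareDispersion 1 0)
      (chemicalPotentialOfDensity (squareDispersion 1 0) (1 - δ)) 1 χs)
    nlinarith
  · -- (iv) node covering on [a, b]
    intro δ hδ
    obtain ⟨g, n, f, hg, hgval, hf, horth, hcov⟩ := hiv δ hδ
    refine ⟨g, n, f, hg, ?_, fun i => ⟨(hf i).1, ?_⟩, horth, hcov⟩
    · show pairingForm (squareDispersion 1 0) (chemicalPotentialOfDensity (squareDispersion 1 0) (1 - δ)) U g =
        channelInf (squareDispersion 1 0) (chemicalPotentialOfDensity (squareDispersion 1 0) (1 - δ)) U D4Irrep.B1g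
      rw [hform δ hδ U D4Irrep.B1g g (by decide) hg, hgval, hhom δ hδ U D4Irrep.B1g (by decide)]
    · show pairingForm (squareDispersion 1 0) (chemicalPotentialOfDensity (squareDispersion 1 0) (1 - δ)) U (f i) =
        channelInf (squareDispersion 1 0) (chemicalPotentialOfDensity (squareDispersion 1 0) (1 - δ)) U χs
      rw [hform δ hδ U χs (f i) hsA1 (hf i).1, (hf i).2, hhom δ hδ U χs hsA1]

end Summit.HubbardSuperconductivity.HubbardSuperconductivity.Theorems

end
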